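import Summits.Langlands.Langlands.Theses.AnalyticDescent
import Literature.NumberTheory.Automorphic.PairLFunctionPolesRepDataHolds
import Literature.NumberTheory.Automorphic.AutomorphicRepsGLIrreducibleL2HCHolds
import Literature.NumberTheory.Automorphic.PairLFunctionMeromorphicContinuationNeConjProofs
import Literature.NumberTheory.Automorphic.PairLFunctionPolesRepDataBoundaryRankOne

/-!
# Line `halves` — skeleton for the crux `PairLBoundaryJS` (stmt-Langlands-13622), crux-strategist s1

ALTERNATIVE line (`--alt` semantics: it never touches the lead's line `Sketch`).

Conclusion decl: `Summit.Langlands.Langlands.Theses.AnalyticDescent.PairLBoundaryJS` — one of the six route aliases of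
item stmt-Langlands-13622 (all have the same text; `Iff.rfl` with the Literature fact, see
`partialPairL_boundary_repData_of_stubs` below). The `IrreducibilityBySelfDuality` module was incoherent on the farm
at publish time (2026-08-17T06:4xZ); for `ledger skeleton check` pass
`--crux-decl Summit.Langlands.Langlands.Theses.AnalyticDescent.PairLBoundaryJS`, or switch the import back.

## Idea
Arthur–Clozel (2.2) is, in print, the conjunction of two theorems with DIFFERENT engines, and the
lead's line `Sketch` pays for both with one currency (the Mœglin–Waldspurger whole-strip continuation,
hence the archimedean Γ-realisation fact `HumphriesJo2024_archRankinSelberg_testVector`). This line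
cuts the crux along the printed seam instead, on the crux's own binder telescope:

* `stub_js_rank_ne` — the **Jacquet–Shalika half for `n ≠ m`**: the limit of `L^S(s, α × β)` at every
  `s₀` on `Re s = 1` EXISTS (no `X`-condition arises). Engine: the JPSS corner/gap integrals the lead
  LANDED (`…CornerGlobal`, `…GapGlobalTranslate`, LOCAL★ finite-place control), needing at `∞` only
  absolute convergence of `K_∞`-finite local integrals near `Re s ≥ 1` and ONE datum with
  `Ψ_∞(s₀) ≠ 0` (density of Kirillov restrictions) — NOT the entire-ratio control
  `JacquetShalika1990_archRankinSelbergGap_entireRatio` and no continuation into the strip.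
* `stub_js_rank_eq` — the **Jacquet–Shalika half for `n = m` off `X`**: same conclusion; engine: the
  `GL_n × GL_n` integral against the mirabolic Eisenstein series (poles only at `s = 0, 1`, residues
  `∝ ⟨φ, φ̄′⟩ = 0` for orthogonal pairs — the tree's leaf hB shape), again with only the two SOFT
  archimedean inputs at the boundary point (Jacquet–Shalika I §3), no Humphries–Jo.
* `stub_sh_half` — the **Shahidi half in reciprocal form** (the ideator's `C⁺ = ReciprocalBoundaryValues`):
  at EVERY `s₀` on `Re s = 1`, `(L^S)⁻¹` has a finite limit from the right. Engines: (II) the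
  `ψ`-Whittaker coefficient of the cuspidal-data Eisenstein series on `GL_{n+m}` at the point `s₀ - 1` of
  its UNITARY axis, `E_ψ(s) = c_S(s) / L^S(1+s)` (Shahidi 1980/81; card `unitary-axis-eisenstein`;
  needs new objects), or (I) the lead's Landau road (zero-freeness of the MW continuation on the line).
  This stub carries the XL debt; it is where the two architectures fork, and BOTH close it.

Composition `PairLBoundaryJS_of : js_rank_ne → js_rank_eq → sh_half → PairLBoundaryJS` is PROVED below:
case split on `n = m`; the two limits multiply along the proper filter `𝓝[Re s > 1] s₀`; and
`L^S · (L^S)⁻¹ = 1` on `Re s > 1` by Arthur–Clozel (2.1) in non-vanishing form for Borel–Jacquet data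
(`partialPairProduct_repData_ne_zero`, from the DISCHARGED dictionary leaves and
`partialPairL_ne_zero_of_isSatakeFamilyOf`), whence `c · ℓ = 1`, `c ≠ 0`.

Disproof used: `pairLBoundaryJS_false_without_X` is honoured by `stub_js_rank_eq` (it keeps `¬X`;
the `X`-points are exactly where `ℓ = 0` in `stub_sh_half`); `pairLBoundaryJS_false_without_satakeLink`
is honoured by every stub (the `HasSatakeParamAt` links to honest cuspidal data are kept — the Liouville
family is not a Satake family). No landed Negative lemma refutes an instance of a stub (both halves are
theorems in print: JS II Prop. 3.6; Shahidi AJM 1981 Thm. 5.1).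
-/

noncomputable section

-- `Summit.Langlands.Langlands.…` (summit = sub-problem name, D-0017 layout) trips `dupNamespace`
set_option linter.dupNamespace false

open scoped Topology Classical
open NumberField IsDedekindDomain MeasureTheory Filter
open Literature.NumberTheory.Automorphic AdelicGroupData

-- Mathlib idiom; needed to mention Borel–Jacquet data, as in `PairLFunctionPolesRepData`
attribute [local instance 100] LieRing.ofAssociativeRing

namespace Summit.Langlands.Langlands.Cruxes.PairLBoundaryJS.Halves

/-! ## Registered stubs -/

/-- **STUB (L) — Jacquet–Shalika half, unequal rank.** For cuspidal Borel–Jacquet data `π` on `GL_n`,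
`π′` on `GL_m`, `n ≠ m`: off a finite `S₀`, for all finite `S ⊇ S₀`, all unitary Satake families and
every `s₀` with `Re s₀ = 1`, `lim_{s → s₀, Re s > 1} L^S(s, α × β)` exists. Jacquet–Shalika II,
Prop. 3.6 (JPSS integrals; soft archimedean input only). -/
theorem stub_js_rank_ne :
    ∀ (n m : ℕ) (F : Type) [Field F] [NumberField F] (hF : Literature.NumberTheory.Automorphic.isCompact_glFiniteIntegralLevel n F) (hF' : Literature.NumberTheory.Automorphic.isCompact_glFiniteIntegralLevel m F), 0 < n → 0 < m → n ≠ m → ∀ (π : Literature.NumberTheory.Automorphic.CuspidalAutomorphicRepData n F hF) (π' : Literature.NumberTheory.Automorphic.CuspidalAutomorphicRepData m F hF'), ∃ S₀ : Set (IsDedekindDomain.HeightOneSpectrum (NumberField.RingOfIntegers F)), S₀.Finite ∧ ∀ {S : Set (IsDedekindDomain.HeightOneSpectrum (NumberField.RingOfIntegers F))}, S.Finite → S₀ ⊆ S → ∀ {α β : IsDedekindDomain.HeightOneSpectrum (NumberField.RingOfIntegers F) → Multiset ℂ}, (∀ w ∉ S, π.1.HasSatakeParamAt w (α w)) → (∀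 w ∉ S, π'.1.HasSatakeParamAt w (β w)) → (∀ w ∉ S, ‖(α w).prod‖ = 1) → (∀ w ∉ S, ‖(β w).prod‖ = 1) → ∀ {s₀ : ℂ}, s₀.re = 1 → ∃ c : ℂ, Tendsto (fun s : ℂ => ∏' w : {w : IsDedekindDomain.HeightOneSpectrum (NumberField.RingOfIntegers F) // w ∉ S}, ((Literature.NumberTheory.Automorphic.satakePairPolynomial (α w.1) (β w.1)).eval ((w.1.residueCard : ℂ) ^ (-s)))⁻¹) (𝓝[{s : ℂ | 1 < s.re}] s₀) (𝓝 c) := by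
  sorry

/-- **STUB (L+) — Jacquet–Shalika half, equal rank, off `X`.** For cuspidal Borel–Jacquet data `π`,
`π′` on `GL_n`: off a finite `S₀`, for all finite `S ⊇ S₀`, all unitary Satake families and every `s₀`
with `Re s₀ = 1` such that NOT (`q_w^{1-s₀} α_w = β_w⁻¹` for almost all `w`),
`lim_{s → s₀, Re s > 1} L^S(s, α × β)` exists. Jacquet–Shalika II, Prop. 3.6 (mirabolic Eisenstein
integral; residues killed by orthogonality; soft archimedean input only). -/
theorem stub_js_rank_eq :
    ∀ (n : ℕ) (F : Type) [Field F] [NumberField F] (hF : Literature.NumberTheory.Automorphic.isCompact_glFiniteIntegralLevel n F) (hF' : Literature.NumberTheory.Automorphic.isCompact_glFiniteIntegralLevel n F), 0 < n → ∀ (π : Literature.NumberTheory.Automorphic.CuspidalAutomorphicRepData n F hF) (π' : Literature.NumberTheory.Automorphic.CuspidalAutomorphicRepData n F hF'), ∃ S₀ : Set (IsDedekindDomain.HeightOneSpectrum (NumberField.RingOfIntegers F)), S₀.Finite ∧ ∀ {S : Set (IsDedekindDomain.HeightOneSpectrum (NumberField.RingOfIntegers F))}, S.Finite → S₀ ⊆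 S → ∀ {α β : IsDedekindDomain.HeightOneSpectrum (NumberField.RingOfIntegers F) → Multiset ℂ}, (∀ w ∉ S, π.1.HasSatakeParamAt w (α w)) → (∀ w ∉ S, π'.1.HasSatakeParamAt w (β w)) → (∀ w ∉ S, ‖(α w).prod‖ = 1) → (∀ w ∉ S, ‖(β w).prod‖ = 1) → ∀ {s₀ : ℂ}, s₀.re = 1 → ¬ (∀ᶠ w in cofinite, (α w).map ((((w.residueCard : ℂ) ^ (1 - s₀))) * ·) = (β w).map (·⁻¹)) → ∃ c : ℂ, Tendsto (fun s : ℂ => ∏' w : {w : IsDedekindDomain.HeightOneSpectrum (NumberField.RingOfIntegers F) // w ∉ S}, ((Literature.NumberTheory.Automorphic.satakePairPolynomial (α w.1) (β w.1)).eval ((w.1.residueCard : ℂ) ^ (-s)))⁻¹) (𝓝[{s : ℂ | 1 < s.re}] s₀) (𝓝 c) := by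
  sorry

/-- **STUB (XL) — Shahidi half in reciprocal form.** For cuspidal Borel–Jacquet data `π` on `GL_n`,
`π′` on `GL_m`: off a finite `S₀`, for all finite `S ⊇ S₀`, all unitary Satake families and EVERY `s₀`
with `Re s₀ = 1`, `lim_{s → s₀, Re s > 1} L^S(s, α × β)⁻¹` exists (it is `0` exactly at the poles).
Shahidi, AJM 103 (1981) Thm. 5.1 / BAMS 2 (1980) (unitary axis of the Eisenstein series on `GL_{n+m}`),
or the zero-freeness of the Mœglin–Waldspurger continuation (`PairLFunctionBoundaryLandau`). -/
theorem stub_sh_half :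
    ∀ (n m : ℕ) (F : Type) [Field F] [NumberField F] (hF : Literature.NumberTheory.Automorphic.isCompact_glFiniteIntegralLevel n F) (hF' : Literature.NumberTheory.Automorphic.isCompact_glFiniteIntegralLevel m F), 0 < n → 0 < m → ∀ (π : Literature.NumberTheory.Automorphic.CuspidalAutomorphicRepData n F hF) (π' : Literature.NumberTheory.Automorphic.CuspidalAutomorphicRepData m F hF'), ∃ S₀ : Set (IsDedekindDomain.HeightOneSpectrum (NumberField.RingOfIntegers F)), S₀.Finite ∧ ∀ {S : Set (IsDedekindDomain.HeightOneSpectrum (NumberField.RingOfIntegers F))}, S.Finite → S₀ ⊆ S → ∀ {α β : IsDedekindDomain.HeightOneSpectrum (NumberField.RingOfIntegers F) → Multiset ℂ}, (∀ w ∉ S, π.1.HasSatakeParamAt w (α w)) → (∀ w ∉ S, π'.1.HasSatakeParamAt w (β w)) → (∀ w ∉ S, ‖(α w).prod‖ = 1) → (∀ w ∉ S, ‖(β w).prod‖ = 1) → ∀ {s₀ : ℂ}, s₀.re = 1 → ∃ ℓ : ℂ, Tendsto (fun s : ℂ => (∏' w : {w : IsDedekindDomain.HeightOneSpectrum (NumberField.RingOfIntegers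 F) // w ∉ S}, ((Literature.NumberTheory.Automorphic.satakePairPolynomial (α w.1) (β w.1)).eval ((w.1.residueCard : ℂ) ^ (-s)))⁻¹)⁻¹) (𝓝[{s : ℂ | 1 < s.re}] s₀) (𝓝 ℓ) := by
  sorry

/-! ## Proved glue -/

/-- **Arthur–Clozel (2.1), non-vanishing form, for Borel–Jacquet data (a theorem).** For cuspidal
`π` on `GL_n(𝔸_F)`, `σ` on `GL_m(𝔸_F)` there is a finite `S₀` such that for every finite `S ⊇ S₀` and
all unitary Satake families `α`, `β` of `π`, `σ` off `S`, the Euler product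
`∏'_{v ∉ S} P_{α,β,v}(q_v^{-s})⁻¹` is non-zero for `Re s > 1`: unitary normalisation
`t_{π,w} = q_w^{s₁} t_{Π,w}`, `t_{σ,w} = q_w^{s₂} t_{Σ,w}` in `L²_cusp` (`re s₁ = re s₂ = 0`), the factors
are those of `(Π, Σ)` at `s - s₁ - s₂` (`pairEulerFactor_eq_of_shift`), and there the product is
`exp` of a convergent sum (`partialPairL_ne_zero_of_isSatakeFamilyOf`).
[cite: ArthurClozelAMS120, Ch. 3 §2 (2.1), p. 171] [cite: JacquetShalikaAJM1981, Thm. (5.3)] -/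
theorem partialPairProduct_repData_ne_zero (n m : ℕ) (F : Type) [Field F] [NumberField F]
    (hF : isCompact_glFiniteIntegralLevel n F) (hF' : isCompact_glFiniteIntegralLevel m F)
    (hn : 0 < n) (hm : 0 < m)
    (π : CuspidalAutomorphicRepData n F hF) (π' : CuspidalAutomorphicRepData m F hF') :
    ∃ S₀ : Set (HeightOneSpectrum (𝓞 F)), S₀.Finite ∧
      ∀ {S : Set (HeightOneSpectrum (𝓞 F))}, S.Finite → S₀ ⊆ S →
        ∀ {α β : HeightOneSpectrum (𝓞 F) → Multiset ℂ},
          (∀ w ∉ S, π.1.HasSatakeParamAt w (α w)) → (∀ w ∉ S, π'.1.HasSatakeParamAt w (β w)) →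
          (∀ w ∉ S, ‖(α w).prod‖ = 1) → (∀ w ∉ S, ‖(β w).prod‖ = 1) →
          ∀ {s : ℂ}, 1 < s.re →
            (∏' v : {v : HeightOneSpectrum (𝓞 F) // v ∉ S},
              ((satakePairPolynomial (α v.1) (β v.1)).eval ((v.1.residueCard : ℂ) ^ (-s)))⁻¹) ≠ 0 := by
  haveI : NeZero n := ⟨hn.ne'⟩
  haveI : NeZero m := ⟨hm.ne'⟩
  obtain ⟨μ, hμ⟩ := AdelicGroupData.exists_isAutomorphicMeasure_gl_holds n F
  obtain ⟨μ', hμ'⟩ := AdelicGroupData.exists_isAutomorphicMeasure_gl_holds m F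
  haveI := hμ
  haveI := hμ'
  -- unitary normalisations of the two data in `L²_cusp` (Borel–Jacquet 1979, 5.7; discharged leaves)
  have hN : ∀ {k : ℕ} (hK : isCompact_glFiniteIntegralLevel k F) [NeZero k]
      (ν : Measure (gl k F).automorphicQuotient) [(gl k F).IsAutomorphicMeasure ν]
      (τ : CuspidalAutomorphicRepData k F hK),
      ∃ (s : ℂ) (P : CuspidalAutomorphicRepGL k F ν) (S : Set (HeightOneSpectrum (𝓞 F)))
        (αP : SatakeFamily F), S.Finite ∧ IsSatakeFamilyOf P S αP ∧
        ∀ w ∉ S, ∀ β : Multiset ℂ,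
          τ.1.HasSatakeParamAt w β ↔ β = (αP w).map (((w.residueCard : ℂ) ^ s) * ·) :=
    fun hK _ ν _ τ =>
      CuspidalAutomorphicRepData.exists_satake_eq_cpow_mul_L2_of_realisation
        (fun _ _ _ => AutomorphicRepsGL.exists_le_formsOfL2_of_W'_eq_bot_holds)
        (fun hK' _ ρ => CuspidalAutomorphicRepData.exists_clean_hasSatakeParamAt_of_sSup_irreducible
          AutomorphicRepsGL.stable_cuspidal_eq_sSup_irreducible_holds ρ) hK ν τ
  obtain ⟨s₁, s₂, P, P', S₀, αP, αP', hS₀, hαP, hαP', hiff, hiff'⟩ :=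
    CuspidalAutomorphicRepData.exists_pair_satake_eq_cpow_mul_of_normalisation (hN hF μ π)
      (hN hF' μ' π')
  refine ⟨S₀, hS₀, ?_⟩
  intro S hS hS₀S α β hα hβ hu hu' s hs
  have hαe := eq_map_cpow_mul_of_hasSatakeParamAt hS₀S hiff hα
  have hβe := eq_map_cpow_mul_of_hasSatakeParamAt hS₀S hiff' hβ
  haveI := infinite_heightOneSpectrum F
  obtain ⟨w₀, hw₀⟩ := hS.infinite_compl.nonempty
  have hs₁ : s₁.re = 0 :=
    re_eq_zero_of_norm_prod_eq_one_of_shift (hαP.mono hS₀S) hn hw₀ (hαe w₀ hw₀) (hu w₀ hw₀)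
  have hs₂ : s₂.re = 0 :=
    re_eq_zero_of_norm_prod_eq_one_of_shift (hαP'.mono hS₀S) hm hw₀ (hβe w₀ hw₀) (hu' w₀ hw₀)
  rw [pairEulerFactor_eq_of_shift hαe hβe s]
  have hre : 1 < (s - (s₁ + s₂)).re := by
    rwa [Complex.sub_re, Complex.add_re, hs₁, hs₂, add_zero, sub_zero]
  simpa only [partialPairL] using
    partialPairL_ne_zero_of_isSatakeFamilyOf P P' (hαP.mono hS₀S) (hαP'.mono hS₀S) hre

/-- **The Jacquet–Shalika half at all ranks** from its two rank regimes (case split on `n = m`;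
for `n = m` the crux's `¬ (n = m ∧ X)` is `¬ X`). [folklore] -/
theorem js_half_of_rank_ne_of_rank_eq
    (hne : ∀ (n m : ℕ) (F : Type) [Field F] [NumberField F] (hF : Literature.NumberTheory.Automorphic.isCompact_glFiniteIntegralLevel n F) (hF' : Literature.NumberTheory.Automorphic.isCompact_glFiniteIntegralLevel m F), 0 < n → 0 < m → n ≠ m → ∀ (π : Literature.NumberTheory.Automorphic.CuspidalAutomorphicRepData n F hF) (π' : Literature.NumberTheory.Automorphic.CuspidalAutomorphicRepData m F hF'), ∃ S₀ : Set (IsDedekindDomain.HeightOneSpectrum (NumberField.RingOfIntegers F)), S₀.Finite ∧ ∀ {S : Set (IsDedekindDomain.HeightOneSpectrum (NumberField.RingOfIntegers F))}, S.Finite → S₀ ⊆ S → ∀ {α β : IsDedekindDomain.HeightOneSpectrum (NumberField.RingOfIntegers F) → Multiset ℂ}, (∀ w ∉ S, π.1.HasSatakeParamAt w (α w)) → (∀ w ∉ S, π'.1.HasSatakeParamAt w (β w)) → (∀ w ∉ S, ‖(α w).prod‖ = 1) → (∀ w ∉ S, ‖(β w).prod‖ = 1) → ∀ {s₀ : ℂ},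 s₀.re = 1 → ∃ c : ℂ, Tendsto (fun s : ℂ => ∏' w : {w : IsDedekindDomain.HeightOneSpectrum (NumberField.RingOfIntegers F) // w ∉ S}, ((Literature.NumberTheory.Automorphic.satakePairPolynomial (α w.1) (β w.1)).eval ((w.1.residueCard : ℂ) ^ (-s)))⁻¹) (𝓝[{s : ℂ | 1 < s.re}] s₀) (𝓝 c))
    (heq : ∀ (n : ℕ) (F : Type) [Field F] [NumberField F] (hF : Literature.NumberTheory.Automorphic.isCompact_glFiniteIntegralLevel n F) (hF' : Literature.NumberTheory.Automorphic.isCompact_glFiniteIntegralLevel n F), 0 < n → ∀ (π : Literature.NumberTheory.Automorphic.CuspidalAutomorphicRepData n F hF) (π' : Literature.NumberTheory.Automorphic.CuspidalAutomorphicRepData n F hF'), ∃ S₀ : Set (IsDedekindDomain.HeightOneSpectrum (NumberField.RingOfIntegers F)), S₀.Finite ∧ ∀ {S : Set (IsDedekindDomain.HeightOneSpectrum (NumberField.RingOfIntegers F))}, S.Finite → S₀ ⊆ S → ∀ {α β : IsDedekindDomain.HeightOneSpectrum (NumberField.RingOfIntegers F) → Multiset ℂ}, (∀ w ∉ S, π.1.HasSatakeParamAt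 w (α w)) → (∀ w ∉ S, π'.1.HasSatakeParamAt w (β w)) → (∀ w ∉ S, ‖(α w).prod‖ = 1) → (∀ w ∉ S, ‖(β w).prod‖ = 1) → ∀ {s₀ : ℂ}, s₀.re = 1 → ¬ (∀ᶠ w in cofinite, (α w).map ((((w.residueCard : ℂ) ^ (1 - s₀))) * ·) = (β w).map (·⁻¹)) → ∃ c : ℂ, Tendsto (fun s : ℂ => ∏' w : {w : IsDedekindDomain.HeightOneSpectrum (NumberField.RingOfIntegers F) // w ∉ S}, ((Literature.NumberTheory.Automorphic.satakePairPolynomial (α w.1) (β w.1)).eval ((w.1.residueCard : ℂ) ^ (-s)))⁻¹) (𝓝[{s : ℂ | 1 < s.re}] s₀) (𝓝 c)) :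
    ∀ (n m : ℕ) (F : Type) [Field F] [NumberField F] (hF : Literature.NumberTheory.Automorphic.isCompact_glFiniteIntegralLevel n F) (hF' : Literature.NumberTheory.Automorphic.isCompact_glFiniteIntegralLevel m F), 0 < n → 0 < m → ∀ (π : Literature.NumberTheory.Automorphic.CuspidalAutomorphicRepData n F hF) (π' : Literature.NumberTheory.Automorphic.CuspidalAutomorphicRepData m F hF'), ∃ S₀ : Set (IsDedekindDomain.HeightOneSpectrum (NumberField.RingOfIntegers F)), S₀.Finite ∧ ∀ {S : Set (IsDedekindDomain.HeightOneSpectrum (NumberField.RingOfIntegers F))}, S.Finite → S₀ ⊆ S → ∀ {α β : IsDedekindDomain.HeightOneSpectrum (NumberField.RingOfIntegers F) → Multiset ℂ}, (∀ w ∉ S, π.1.HasSatakeParamAt w (α w)) → (∀ w ∉ S, π'.1.HasSatakeParamAt w (β w)) → (∀ w ∉ S, ‖(α w).prod‖ = 1) → (∀ w ∉ S, ‖(β w).prod‖ = 1) → ∀ {s₀ : ℂ}, s₀.re = 1 → ¬ (n = m ∧ ∀ᶠ w in cofinite, (α w).map ((((w.residueCard : ℂ) ^ (1 - s₀))) * ·)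 = (β w).map (·⁻¹)) → ∃ c : ℂ, Tendsto (fun s : ℂ => ∏' w : {w : IsDedekindDomain.HeightOneSpectrum (NumberField.RingOfIntegers F) // w ∉ S}, ((Literature.NumberTheory.Automorphic.satakePairPolynomial (α w.1) (β w.1)).eval ((w.1.residueCard : ℂ) ^ (-s)))⁻¹) (𝓝[{s : ℂ | 1 < s.re}] s₀) (𝓝 c) := by
  intro n m F _ _ hF hF' hn hm π π'
  by_cases hnm : n = m
  · subst hnm
    obtain ⟨S₀, hS₀, h⟩ := heq n F hF hF' hn π π'
    refine ⟨S₀, hS₀, ?_⟩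
    intro S hS hsub α β hα hβ hu hu' s₀ hs₀ hX
    exact h hS hsub hα hβ hu hu' hs₀ fun hX' => hX ⟨rfl, hX'⟩
  · obtain ⟨S₀, hS₀, h⟩ := hne n m F hF hF' hn hm hnm π π'
    refine ⟨S₀, hS₀, ?_⟩
    intro S hS hsub α β hα hβ hu hu' s₀ hs₀ _hX
    exact h hS hsub hα hβ hu hu' hs₀

/-- **The crux from the two halves** (Jacquet–Shalika half at all ranks + Shahidi half in reciprocal
form): the limits multiply along the proper filter `𝓝[Re s > 1] s₀`, and `L^S · (L^S)⁻¹ = 1` on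
`Re s > 1` by (2.1) in non-vanishing form, so `c · ℓ = 1` and `c ≠ 0`.
[cite: ArthurClozelAMS120, Ch. 3 §2 (2.2), p. 171] -/
theorem PairLBoundaryJS_of_halves
    (hJS : ∀ (n m : ℕ) (F : Type) [Field F] [NumberField F] (hF : Literature.NumberTheory.Automorphic.isCompact_glFiniteIntegralLevel n F) (hF' : Literature.NumberTheory.Automorphic.isCompact_glFiniteIntegralLevel m F), 0 < n → 0 < m → ∀ (π : Literature.NumberTheory.Automorphic.CuspidalAutomorphicRepData n F hF) (π' : Literature.NumberTheory.Automorphic.CuspidalAutomorphicRepData m F hF'), ∃ S₀ : Set (IsDedekindDomain.HeightOneSpectrum (NumberField.RingOfIntegers F)), S₀.Finite ∧ ∀ {S : Set (IsDedekindDomain.HeightOneSpectrum (NumberField.RingOfIntegers F))}, S.Finite → S₀ ⊆ S → ∀ {α β : IsDedekindDomain.HeightOneSpectrum (NumberField.RingOfIntegers F) → Multiset ℂ}, (∀ w ∉ S, π.1.HasSatakeParamAt w (α w)) → (∀ w ∉ S, π'.1.HasSatakeParamAt w (β w)) → (∀ w ∉ S, ‖(α w).prod‖ = 1) → (∀ w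 ∉ S, ‖(β w).prod‖ = 1) → ∀ {s₀ : ℂ}, s₀.re = 1 → ¬ (n = m ∧ ∀ᶠ w in cofinite, (α w).map ((((w.residueCard : ℂ) ^ (1 - s₀))) * ·) = (β w).map (·⁻¹)) → ∃ c : ℂ, Tendsto (fun s : ℂ => ∏' w : {w : IsDedekindDomain.HeightOneSpectrum (NumberField.RingOfIntegers F) // w ∉ S}, ((Literature.NumberTheory.Automorphic.satakePairPolynomial (α w.1) (β w.1)).eval ((w.1.residueCard : ℂ) ^ (-s)))⁻¹) (𝓝[{s : ℂ | 1 < s.re}] s₀) (𝓝 c))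
    (hSh : ∀ (n m : ℕ) (F : Type) [Field F] [NumberField F] (hF : Literature.NumberTheory.Automorphic.isCompact_glFiniteIntegralLevel n F) (hF' : Literature.NumberTheory.Automorphic.isCompact_glFiniteIntegralLevel m F), 0 < n → 0 < m → ∀ (π : Literature.NumberTheory.Automorphic.CuspidalAutomorphicRepData n F hF) (π' : Literature.NumberTheory.Automorphic.CuspidalAutomorphicRepData m F hF'), ∃ S₀ : Set (IsDedekindDomain.HeightOneSpectrum (NumberField.RingOfIntegers F)), S₀.Finite ∧ ∀ {S : Set (IsDedekindDomain.HeightOneSpectrum (NumberField.RingOfIntegers F))}, S.Finite → S₀ ⊆ S → ∀ {α β : IsDedekindDomain.HeightOneSpectrum (NumberField.RingOfIntegers F) → Multiset ℂ}, (∀ w ∉ S, π.1.HasSatakeParamAt w (α w)) → (∀ w ∉ S, π'.1.HasSatakeParamAt w (β w)) → (∀ w ∉ S, ‖(α w).prod‖ = 1) → (∀ w ∉ S, ‖(β w).prod‖ = 1) → ∀ {s₀ : ℂ}, s₀.re = 1 → ∃ ℓ : ℂ, Tendsto (fun s : ℂ => (∏' w : {w : IsDedekindDomain.HeightOneSpectrum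 (NumberField.RingOfIntegers F) // w ∉ S}, ((Literature.NumberTheory.Automorphic.satakePairPolynomial (α w.1) (β w.1)).eval ((w.1.residueCard : ℂ) ^ (-s)))⁻¹)⁻¹) (𝓝[{s : ℂ | 1 < s.re}] s₀) (𝓝 ℓ)) :
    Summit.Langlands.Langlands.Theses.AnalyticDescent.PairLBoundaryJS := by
  intro n m F _ _ hF hF' hn hm π π'
  obtain ⟨S₁, hS₁, h₁⟩ := hJS n m F hF hF' hn hm π π'
  obtain ⟨S₂, hS₂, h₂⟩ := hSh n m F hF hF' hn hm π π'
  obtain ⟨S₃, hS₃, h₃⟩ := partialPairProduct_repData_ne_zero n m F hF hF' hn hm π π'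
  refine ⟨S₁ ∪ S₂ ∪ S₃, (hS₁.union hS₂).union hS₃, ?_⟩
  intro S hS hsub α β hα hβ hu hu' s₀ hs₀ hX
  have h1S : S₁ ⊆ S := Set.subset_union_left.trans (Set.subset_union_left.trans hsub)
  have h2S : S₂ ⊆ S := Set.subset_union_right.trans (Set.subset_union_left.trans hsub)
  have h3S : S₃ ⊆ S := Set.subset_union_right.trans hsub
  obtain ⟨c, hc⟩ := h₁ hS h1S hα hβ hu hu' hs₀ hX
  obtain ⟨ℓ, hℓ⟩ := h₂ hS h2S hα hβ hu hu' hs₀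
  -- abbreviate the Euler product
  set L : ℂ → ℂ := fun s : ℂ => ∏' w : {w : HeightOneSpectrum (𝓞 F) // w ∉ S},
    ((satakePairPolynomial (α w.1) (β w.1)).eval ((w.1.residueCard : ℂ) ^ (-s)))⁻¹ with hLdef
  have hne : ∀ s : ℂ, 1 < s.re → L s ≠ 0 := fun s hs => h₃ hS h3S hα hβ hu hu' hs
  -- the boundary filter is proper: `s₀` is in the closure of `{1 < re}`
  haveI : (𝓝[{s : ℂ | 1 < s.re}] s₀).NeBot := by
    refine mem_closure_iff_nhdsWithin_neBot.mp ?_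
    rw [Complex.closure_setOf_lt_re]
    simp [hs₀]
  have hprod : Tendsto (fun s => L s * (L s)⁻¹) (𝓝[{s : ℂ | 1 < s.re}] s₀) (𝓝 (c * ℓ)) :=
    hc.mul hℓ
  have hone : Tendsto (fun s => L s * (L s)⁻¹) (𝓝[{s : ℂ | 1 < s.re}] s₀) (𝓝 1) := by
    refine tendsto_const_nhds.congr' ?_
    filter_upwards [self_mem_nhdsWithin] with s hs
    exact (mul_inv_cancel₀ (hne s hs)).symm
  have hcl : c * ℓ = 1 := tendsto_nhds_unique hprod hone
  refine ⟨c, ?_, hc⟩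
  rintro rfl
  simp at hcl


/-! ## Special case proved now (sanity of `stub_sh_half`): ranks `(1, 1)` -/

/-- **`stub_sh_half` at `n = m = 1`, unconditionally** (Hecke `L`-functions of the idele classes over
any number field): off `X` the tree's theorem `JacquetShalika1981_partialPairL_boundary_repData_one_one`
gives `L^S → c ≠ 0`, so `(L^S)⁻¹ → c⁻¹`; on `X` the theorem
`JacquetShalika1981_partialPairL_pole_repData_one` gives `(s - s₀) L^S → c ≠ 0`, so
`(L^S)⁻¹ = (s - s₀) · ((s - s₀) L^S)⁻¹ → 0`. The same two-case argument shows in every rank that the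
Shahidi half is a CONSEQUENCE of Arthur–Clozel (2.2) ∧ (2.3) (consistency of the stub with the printed
theory); it is used toward (2.2) in `PairLBoundaryJS_of`. [cite: ArthurClozelAMS120, Ch. 3 §2 (2.2)–(2.3)] -/
theorem sh_half_one_one :
    ∀ (F : Type) [Field F] [NumberField F] (hF hF' : Literature.NumberTheory.Automorphic.isCompact_glFiniteIntegralLevel 1 F) (π : Literature.NumberTheory.Automorphic.CuspidalAutomorphicRepData 1 F hF) (π' : Literature.NumberTheory.Automorphic.CuspidalAutomorphicRepData 1 F hF'), ∃ S₀ : Set (IsDedekindDomain.HeightOneSpectrum (NumberField.RingOfIntegers F)), S₀.Finite ∧ ∀ {S : Set (IsDedekindDomain.HeightOneSpectrum (NumberField.RingOfIntegers F))}, S.Finite → S₀ ⊆ S → ∀ {α β : IsDedekindDomain.HeightOneSpectrum (NumberField.RingOfIntegers F) → Multiset ℂ}, (∀ w ∉ S, π.1.HasSatakeParamAt w (α w)) → (∀ w ∉ S, π'.1.HasSatakeParamAt w (β w)) → (∀ w ∉ S, ‖(α w).prod‖ = 1) → (∀ w ∉ S, ‖(β w).prod‖ = 1) → ∀ {s₀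 : ℂ}, s₀.re = 1 → ∃ ℓ : ℂ, Tendsto (fun s : ℂ => (∏' w : {w : IsDedekindDomain.HeightOneSpectrum (NumberField.RingOfIntegers F) // w ∉ S}, ((Literature.NumberTheory.Automorphic.satakePairPolynomial (α w.1) (β w.1)).eval ((w.1.residueCard : ℂ) ^ (-s)))⁻¹)⁻¹) (𝓝[{s : ℂ | 1 < s.re}] s₀) (𝓝 ℓ) := by
  intro F _ _ hF hF' π π'
  obtain ⟨S₁, hS₁, h₁⟩ := JacquetShalika1981_partialPairL_boundary_repData_one_one hF hF' π π'
  obtain ⟨S₂, hS₂, h₂⟩ := JacquetShalika1981_partialPairL_pole_repData_one hF π π'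
  refine ⟨S₁ ∪ S₂, hS₁.union hS₂, ?_⟩
  intro S hS hsub α β hα hβ hu hu' s₀ hs₀
  by_cases hX : ∀ᶠ w in cofinite,
      (α w).map (((w.residueCard : ℂ) ^ (1 - s₀)) * ·) = (β w).map (·⁻¹)
  · -- a pole: `(L^S)⁻¹ = (s - s₀) · ((s - s₀) L^S)⁻¹ → 0 · c⁻¹`
    obtain ⟨c, hc0, hc⟩ := h₂ hS (Set.subset_union_right.trans hsub) hα hβ hu hu' hs₀ hX
    refine ⟨0, ?_⟩
    have hlin : Tendsto (fun s : ℂ => s - s₀) (𝓝[{s : ℂ | 1 < s.re}] s₀) (𝓝 0) := by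
      have : Tendsto (fun s : ℂ => s - s₀) (𝓝 s₀) (𝓝 (s₀ - s₀)) :=
        (continuous_id.sub continuous_const).tendsto s₀
      rw [sub_self] at this
      exact this.mono_left nhdsWithin_le_nhds
    have hmul := hlin.mul (hc.inv₀ hc0)
    rw [zero_mul] at hmul
    refine hmul.congr' ?_
    filter_upwards [self_mem_nhdsWithin] with s hs
    have hs0 : s - s₀ ≠ 0 := by
      intro h
      have : s.re = s₀.re := by rw [sub_eq_zero.mp h]
      rw [hs₀] at this
      exact (lt_irrefl (1 : ℝ)) (this ▸ hs)
    simp only [partialPairL, mul_inv_rev]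
    rw [mul_comm ((∏' _, _)⁻¹) _, ← mul_assoc, mul_inv_cancel₀ hs0, one_mul]
  · obtain ⟨c, hc0, hc⟩ := h₁ hS (Set.subset_union_left.trans hsub) hα hβ hu hu' hs₀
      (fun h => hX h.2)
    exact ⟨c⁻¹, by simpa only [partialPairL] using hc.inv₀ hc0⟩

/-! ## Composition -/

/-- **The crux from the stubs**: `PairLBoundaryJS` (Arthur–Clozel (2.2) for Borel–Jacquet data, all
ranks) from `stub_js_rank_ne`, `stub_js_rank_eq`, `stub_sh_half`. -/
theorem PairLBoundaryJS_of :
    (∀ (n m : ℕ) (F : Type) [Field F] [NumberField F] (hF : Literature.NumberTheory.Automorphic.isCompact_glFiniteIntegralLevel n F) (hF' : Literature.NumberTheory.Automorphic.isCompact_glFiniteIntegralLevel m F), 0 < n → 0 < m → n ≠ m → ∀ (π : Literature.NumberTheory.Automorphic.CuspidalAutomorphicRepData n F hF) (π' : Literature.NumberTheory.Automorphic.CuspidalAutomorphicRepData m F hF'), ∃ S₀ : Set (IsDedekindDomain.HeightOneSpectrum (NumberField.RingOfIntegers F)), S₀.Finite ∧ ∀ {S : Set (IsDedekindDomain.HeightOneSpectrum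 (NumberField.RingOfIntegers F))}, S.Finite → S₀ ⊆ S → ∀ {α β : IsDedekindDomain.HeightOneSpectrum (NumberField.RingOfIntegers F) → Multiset ℂ}, (∀ w ∉ S, π.1.HasSatakeParamAt w (α w)) → (∀ w ∉ S, π'.1.HasSatakeParamAt w (β w)) → (∀ w ∉ S, ‖(α w).prod‖ = 1) → (∀ w ∉ S, ‖(β w).prod‖ = 1) → ∀ {s₀ : ℂ}, s₀.re = 1 → ∃ c : ℂ, Tendsto (fun s : ℂ => ∏' w : {w : IsDedekindDomain.HeightOneSpectrum (NumberField.RingOfIntegers F) // w ∉ S}, ((Literature.NumberTheory.Automorphic.satakePairPolynomial (α w.1) (β w.1)).eval ((w.1.residueCard : ℂ) ^ (-s)))⁻¹) (𝓝[{s : ℂ | 1 < s.re}] s₀) (𝓝 c)) →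
    (∀ (n : ℕ) (F : Type) [Field F] [NumberField F] (hF : Literature.NumberTheory.Automorphic.isCompact_glFiniteIntegralLevel n F) (hF' : Literature.NumberTheory.Automorphic.isCompact_glFiniteIntegralLevel n F), 0 < n → ∀ (π : Literature.NumberTheory.Automorphic.CuspidalAutomorphicRepData n F hF) (π' : Literature.NumberTheory.Automorphic.CuspidalAutomorphicRepData n F hF'), ∃ S₀ : Set (IsDedekindDomain.HeightOneSpectrum (NumberField.RingOfIntegers F)), S₀.Finite ∧ ∀ {S : Set (IsDedekindDomain.HeightOneSpectrum (NumberField.RingOfIntegers F))}, S.Finite → S₀ ⊆ S → ∀ {α β : IsDedekindDomain.HeightOneSpectrum (NumberField.RingOfIntegers F) → Multiset ℂ}, (∀ w ∉ S, π.1.HasSatakeParamAt w (α w)) → (∀ w ∉ S, π'.1.HasSatakeParamAt w (β w)) → (∀ w ∉ S, ‖(α w).prod‖ = 1) → (∀ w ∉ S, ‖(β w).prod‖ = 1) → ∀ {s₀ : ℂ}, s₀.re = 1 → ¬ (∀ᶠ w in cofinite, (α w).map ((((w.residueCard : ℂ) ^ (1 - s₀))) * ·) = (β w).map (·⁻¹))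 → ∃ c : ℂ, Tendsto (fun s : ℂ => ∏' w : {w : IsDedekindDomain.HeightOneSpectrum (NumberField.RingOfIntegers F) // w ∉ S}, ((Literature.NumberTheory.Automorphic.satakePairPolynomial (α w.1) (β w.1)).eval ((w.1.residueCard : ℂ) ^ (-s)))⁻¹) (𝓝[{s : ℂ | 1 < s.re}] s₀) (𝓝 c)) →
    (∀ (n m : ℕ) (F : Type) [Field F] [NumberField F] (hF : Literature.NumberTheory.Automorphic.isCompact_glFiniteIntegralLevel n F) (hF' : Literature.NumberTheory.Automorphic.isCompact_glFiniteIntegralLevel m F), 0 < n → 0 < m → ∀ (π : Literature.NumberTheory.Automorphic.CuspidalAutomorphicRepData n F hF) (π' : Literature.NumberTheory.Automorphic.CuspidalAutomorphicRepData m F hF'), ∃ S₀ : Set (IsDedekindDomain.HeightOneSpectrum (NumberField.RingOfIntegers F)), S₀.Finite ∧ ∀ {S : Set (IsDedekindDomain.HeightOneSpectrum (NumberField.RingOfIntegers F))}, S.Finite → S₀ ⊆ S → ∀ {α β : IsDedekindDomain.HeightOneSpectrum (NumberField.RingOfIntegers F) → Multiset ℂ}, (∀ w ∉ S, π.1.HasSatakeParamAt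 w (α w)) → (∀ w ∉ S, π'.1.HasSatakeParamAt w (β w)) → (∀ w ∉ S, ‖(α w).prod‖ = 1) → (∀ w ∉ S, ‖(β w).prod‖ = 1) → ∀ {s₀ : ℂ}, s₀.re = 1 → ∃ ℓ : ℂ, Tendsto (fun s : ℂ => (∏' w : {w : IsDedekindDomain.HeightOneSpectrum (NumberField.RingOfIntegers F) // w ∉ S}, ((Literature.NumberTheory.Automorphic.satakePairPolynomial (α w.1) (β w.1)).eval ((w.1.residueCard : ℂ) ^ (-s)))⁻¹)⁻¹) (𝓝[{s : ℂ | 1 < s.re}] s₀) (𝓝 ℓ)) →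
    Summit.Langlands.Langlands.Theses.AnalyticDescent.PairLBoundaryJS :=
  fun hne heq hsh => PairLBoundaryJS_of_halves (js_half_of_rank_ne_of_rank_eq hne heq) hsh

/-- The composition instantiated at the stubs (sanity: the skeleton closes the crux by name). -/
theorem PairLBoundaryJS_of_stubs :
    Summit.Langlands.Langlands.Theses.AnalyticDescent.PairLBoundaryJS :=
  PairLBoundaryJS_of stub_js_rank_ne stub_js_rank_eq stub_sh_half

/-- Route-agnostic form: the stubs give the Literature named fact
`JacquetShalika1981_partialPairL_boundary_repData` (definitionally every route's `PairLBoundaryJS`). -/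
theorem partialPairL_boundary_repData_of_stubs : JacquetShalika1981_partialPairL_boundary_repData :=
  (show Summit.Langlands.Langlands.Theses.AnalyticDescent.PairLBoundaryJS ↔
      JacquetShalika1981_partialPairL_boundary_repData from Iff.rfl).mp PairLBoundaryJS_of_stubs

end Summit.Langlands.Langlands.Cruxes.PairLBoundaryJS.Halves

end
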